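import Summits.BirchSwinnertonDyer.BirchSwinnertonDyer.Theorems.AdditiveKolyvaginRoadLevelSystemsEvenLevels
import Summits.BirchSwinnertonDyer.BirchSwinnertonDyer.Theorems.AdditiveKolyvaginRoadLevelRealisation
import HarnessLib

/-!
# Route `AdditiveKolyvaginRoad`, crux `LevelKolyvaginSystemsAdditive` (item stmt-BirchSwinnertonDyer-21396, KS′):
# the HYBRID socket — E's own Kolyvagin classes at level `∅`, ANY classes above, glued by a BOTTOM TRANSFER
# (cell `pub/bsd-wall`, width seat `bsd-wall-akr-p2x-w3` g0 on line `birth`; `--supports stmt-BirchSwinnertonDyer-21396`, helper;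
# kernel form of the composition proposed by the round-1 crux ideas `depleted-shadow-transfer` ∕ `pold-fusion-glue` ∕
# `epsilon-matched-retyping`: «κ(m, ∅) := E's classes, κ(m, n ≠ ∅) := the borrowed classes, transport at ∅ by a transfer»)

WHY THIS FILE. Three of the round-1 crux ideas on KS′ BORROW the classes above level `∅` from a CONGRUENT object (the
`p`-good shadow `g₀` of a finite-flat frame; a congruent form of another tame type with the same local root number;
the `p`-old avatar), keep E's own Kolyvagin classes at level `∅` (the carrier's `realisation` forces them), and glue the
two at the ONE field that mixes the levels `∅` and `{q₁, q₂}` — `transport` from the bottom level `∅` — by a TRANSFER of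
Kolyvagin non-vanishing from the lender to `E` (Kriz–Li-type congruence of Heegner logarithms + Mazur–Rubin ∕ Howard
rigidity in `depleted-shadow-transfer` (A2); the geometric fusion `E[p] ⊂ S_h` in `pold-fusion-glue`). This file is the
kernel SOCKET of that composition, lender-free: it isolates exactly what the borrowed classes and the transfer must
deliver in the carrier's own currency.

* `nonempty_levelKolyvaginSystemP_of_upperLevels_of_bottomTransfer` — at a frame where Kolyvagin–Heegner data exist at
  every Kolyvagin conductor (`K` imaginary quadratic, Heegner for `N_E`, `4N ∣ β² − d_K`: `nonempty_kolyvaginHeegnerData_finsetProd`,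
  akr-p2x g0), GIVEN classes `κ₁(m, n)` used only at NON-EMPTY levels `n` with the carrier's axioms there (`sign`,
  `selmer_off`, `selmer_inf`, `toric_on`, `transverse_on`, `relation`, `baseCase` — their field texts quantify over
  non-empty levels only — and `transport` between non-empty bottom and top levels), and GIVEN the BOTTOM TRANSFER
  «`q₂` off the base locus of `κ₁` at a two-prime level `{q₁, q₂}` ⟹ SOME Kolyvagin–Heegner datum of `E` of Kolyvagin
  conductor has non-zero Kolyvagin class mod `p`», a `LevelKolyvaginSystemP W K p Dt β ι c` EXISTS: at level `∅` take,
  for each conductor `m`, the class of a datum with NON-ZERO class if there is one (else of any datum); above `∅` take `κ₁`.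
* `nonempty_levelKolyvaginSystemP_of_evenUpperLevels_of_bottomTransfer` — the same with the upper-level axioms owed at
  EVEN non-empty levels only (odd levels := 0, via `nonempty_levelKolyvaginSystemP_of_evenLevels`).

So a «borrowing» line owes: (U) upper-level classes IN `H¹(K, E[p])` WITH E's LOCAL KERNELS (the lender's classes
transported along `ρ̄_E ≅ ρ̄_{lender}`, plus the identification of local conditions at every place — at `v ∣ p` this is
the idea's parity ∕ ε-matching input), and (B) the bottom transfer (lender's Kolyvagin non-vanishing ⟹ E's). Nothing
else. HONEST FRAMING: theorems only; 0 definitions, 0 named facts, 0 `sorry`; CONDITIONAL on the displayed hypotheses;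
closes nothing. BSD is not proved by any of this.

References: [cite: WZhang2014, §3.7 (3.21), Thm. 4.3, Thm. 7.2, Def. 8.3, §9] [cite: GrossLMS1991, §4 (4.4)]
[cite: KrizLi2019, Thm. 1.16, Rem. 1.17].
-/

-- single-conjunct summit: `Summit.BirchSwinnertonDyer.BirchSwinnertonDyer.…` repeats the name by design
set_option linter.dupNamespace false

noncomputable section

open scoped Classical

namespace Summit.BirchSwinnertonDyer.BirchSwinnertonDyer.Theorems.AdditiveKoly

open WeierstrassCurve NumberField IsDedekindDomain
  Literature.NumberTheory.EllipticCurves Literature.NumberTheory.EllipticCurves.ModularForms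
  Literature.NumberTheory.GaloisRepresentations Module
  Summit.BirchSwinnertonDyer.Rank1Residual.X11b.Three.Koly

variable (W : WeierstrassCurve ℚ) (K : Type) [Field K] [NumberField K] (p : ℕ) [W.IsGloballyMinimal] (c : K ≃ₐ[ℚ] K)
  [Module (ZMod p) (Vp W K p)] [W.IsElliptic] [NeZero (W.conductorNorm ℤ)] [Fact p.Prime]
  (Dt : ModularParametrizationData W (W.conductorNorm ℤ)) (β : ℤ) (ι : K →+* ℂ)

/-- **The HYBRID socket: E's Kolyvagin classes at level `∅`, arbitrary classes above, glued by a bottom transfer.**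
At a frame with `K` imaginary quadratic, Heegner for `N_E` and `4N ∣ β² − d_K` (so that Kolyvagin–Heegner data of `E`
exist at every Kolyvagin conductor), let `κ₁(m, n) ∈ H¹(K, E[p])` be classes, used only at NON-EMPTY levels `n`, with
the carrier's axioms at non-empty levels (`sign`, `selmer_off`, `selmer_inf`, `toric_on`, `transverse_on`, `relation`,
`baseCase` — field texts verbatim) and `transport` between NON-EMPTY bottom and top levels; and suppose the BOTTOM
TRANSFER: whenever `q₂` is off the base locus of `κ₁` at a two-prime level `insert q₂ (insert q₁ ∅)` (`q₂ ≠ q₁`), some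
Kolyvagin–Heegner datum `d` of `E`, of conductor a product of Kolyvagin primes, has `d.kolyvaginClass ≠ 0`. Then
`LevelKolyvaginSystemP W K p Dt β ι c` is inhabited — by `κ(m, ∅) :=` the class of a datum of conductor `∏ m` with
non-zero class when one exists (else of any datum), `κ(m, n) := κ₁(m, n)` for `n ≠ ∅`. The composition of the crux
ideas `depleted-shadow-transfer` (fields above `∅` from the shadow, (A2) = the bottom transfer) and `pold-fusion-glue`.
[cite: WZhang2014, Thm. 4.3, Thm. 7.2, §9] [cite: GrossLMS1991, §4 (4.4)] -/
theorem nonempty_levelKolyvaginSystemP_of_upperLevels_of_bottomTransfer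
    (hK : IsImaginaryQuadratic K) (hH : SatisfiesHeegnerHypothesis (W.conductorNorm ℤ) K)
    (hβ : (4 * (W.conductorNorm ℤ : ℤ)) ∣ β ^ 2 - NumberField.discr K)
    (ε₀ : Finset (AdmQ W K p) → Bool)
    (κ₁ : Finset {ℓ // Zhang2014.IsKolyvaginPrime (W.conductorNorm ℤ) W K p ℓ} → Finset (AdmQ W K p) → Vp W K p)
    (sign : ∀ n : Finset (AdmQ W K p), n.Nonempty →
      ∀ m : Finset {ℓ // Zhang2014.IsKolyvaginPrime (W.conductorNorm ℤ) W K p ℓ},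
      conjAct W c ((p ^ 1 : ℕ) : ℤ) (κ₁ m n) = sgnP (ε₀ n ^^ Nat.bodd m.card) • κ₁ m n)
    (selmer_off : ∀ n : Finset (AdmQ W K p), n.Nonempty →
      ∀ (m : Finset {ℓ // Zhang2014.IsKolyvaginPrime (W.conductorNorm ℤ) W K p ℓ}) (v : HeightOneSpectrum (𝓞 K)),
      (∀ ℓ ∈ m, ((ℓ : ℕ) : 𝓞 K) ∉ v.asIdeal) → (∀ q ∈ n, ((q : ℕ) : 𝓞 K) ∉ v.asIdeal) →
      κ₁ m n ∈ selmerLocalKer (W.baseChange K) (v.adicCompletion K) ((p ^ 1 : ℕ) : ℤ))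
    (selmer_inf : ∀ n : Finset (AdmQ W K p), n.Nonempty →
      ∀ (m : Finset {ℓ // Zhang2014.IsKolyvaginPrime (W.conductorNorm ℤ) W K p ℓ}) (w : InfinitePlace K),
      κ₁ m n ∈ selmerLocalKer (W.baseChange K) w.Completion ((p ^ 1 : ℕ) : ℤ))
    (toric_on : ∀ n : Finset (AdmQ W K p), n.Nonempty →
      ∀ m : Finset {ℓ // Zhang2014.IsKolyvaginPrime (W.conductorNorm ℤ) W K p ℓ}, ∀ q ∈ n,
      ∀ v : HeightOneSpectrum (𝓞 K),
      ((q : ℕ) : 𝓞 K) ∈ v.asIdeal → κ₁ m n ∈ toricLocalKer (W.baseChange K) (v.adicCompletion K) ((p ^ 1 : ℕ) : ℤ))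
    (transverse_on : ∀ n : Finset (AdmQ W K p), n.Nonempty →
      ∀ m : Finset {ℓ // Zhang2014.IsKolyvaginPrime (W.conductorNorm ℤ) W K p ℓ}, ∀ ℓ ∈ m,
      ∀ v : HeightOneSpectrum (𝓞 K),
      ((ℓ : ℕ) : 𝓞 K) ∈ v.asIdeal → κ₁ m n ∈ transverseLocalKerP W K p ι ℓ v)
    (relation : ∀ n : Finset (AdmQ W K p), n.Nonempty →
      ∀ (m : Finset {ℓ // Zhang2014.IsKolyvaginPrime (W.conductorNorm ℤ) W K p ℓ})
        (ℓ : {ℓ // Zhang2014.IsKolyvaginPrime (W.conductorNorm ℤ) W K p ℓ}), ℓ ∉ m → ∀ v : HeightOneSpectrum (𝓞 K),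
      ((ℓ : ℕ) : 𝓞 K) ∈ v.asIdeal →
      (κ₁ (insert ℓ m) n ∈ (W.baseChange K).torsionLocalKer (v.adicCompletion K) ((p ^ 1 : ℕ) : ℤ) ↔
        κ₁ m n ∈ (W.baseChange K).torsionLocalKer (v.adicCompletion K) ((p ^ 1 : ℕ) : ℤ)))
    (transport_upper : ∀ (n : Finset (AdmQ W K p)) (q₁ q₂ : AdmQ W K p), n.Nonempty →
      q₁ ∉ n → q₂ ∉ insert q₁ n → q₂ ∉ baseLocusQP W K p κ₁ (insert q₂ (insert q₁ n)) → ∃ m, κ₁ m n ≠ 0)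
    (transport_bottom : ∀ q₁ q₂ : AdmQ W K p, q₂ ≠ q₁ →
      q₂ ∉ baseLocusQP W K p κ₁ (insert q₂ (insert q₁ (∅ : Finset (AdmQ W K p)))) →
      ∃ (m : Finset {ℓ // Zhang2014.IsKolyvaginPrime (W.conductorNorm ℤ) W K p ℓ})
        (d : KolyvaginHeegnerData Dt β ι (∏ ℓ ∈ m, (ℓ : ℕ))), d.kolyvaginClass (Fact.out : p.Prime) 1 ≠ 0)
    (baseCase : ∀ n : Finset (AdmQ W K p), n.Nonempty → Even n.card →
      finrank (ZMod p) (SelQP W K p c n true) + finrank (ZMod p) (SelQP W K p c n false) = 1 → κ₁ ∅ n ≠ 0) :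
    Nonempty (LevelKolyvaginSystemP W K p Dt β ι c) := by
  have hp : p.Prime := Fact.out
  -- E's classes at level `∅`: a datum with NON-ZERO class when there is one, else any datum
  let dat : ∀ m : Finset {ℓ // Zhang2014.IsKolyvaginPrime (W.conductorNorm ℤ) W K p ℓ},
      KolyvaginHeegnerData Dt β ι (∏ ℓ ∈ m, (ℓ : ℕ)) := fun m ↦
    if h : ∃ d : KolyvaginHeegnerData Dt β ι (∏ ℓ ∈ m, (ℓ : ℕ)), d.kolyvaginClass hp 1 ≠ 0 then h.choose
    else Classical.choice (nonempty_kolyvaginHeegnerData_finsetProd W K p hK hH Dt β ι hβ m)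
  have hdat : ∀ m : Finset {ℓ // Zhang2014.IsKolyvaginPrime (W.conductorNorm ℤ) W K p ℓ},
      (∃ d : KolyvaginHeegnerData Dt β ι (∏ ℓ ∈ m, (ℓ : ℕ)), d.kolyvaginClass hp 1 ≠ 0) →
      (dat m).kolyvaginClass hp 1 ≠ 0 := by
    intro m h
    have hd : dat m = h.choose := dif_pos h
    rw [hd]
    exact h.choose_spec
  -- the hybrid classes
  let κ : Finset {ℓ // Zhang2014.IsKolyvaginPrime (W.conductorNorm ℤ) W K p ℓ} → Finset (AdmQ W K p) → Vp W K p :=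
    fun m n ↦ if n = ∅ then (dat m).kolyvaginClass hp 1 else κ₁ m n
  have hκ_bot : ∀ m, κ m ∅ = (dat m).kolyvaginClass hp 1 := fun m ↦ if_pos rfl
  have hκ_up : ∀ {n : Finset (AdmQ W K p)} (_ : n.Nonempty) (m), κ m n = κ₁ m n :=
    fun hn m ↦ if_neg hn.ne_empty
  have hbase_up : ∀ {n : Finset (AdmQ W K p)} (_ : n.Nonempty), baseLocusQP W K p κ n = baseLocusQP W K p κ₁ n :=
    fun hn ↦ baseLocusQP_congr W K p fun m ↦ hκ_up hn m
  refine ⟨⟨ε₀, κ, ?_, ?_, ?_, ?_, ?_, ?_, ?_, ?_, ?_⟩⟩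
  · -- realisation
    intro m
    exact ⟨dat m, hκ_bot m⟩
  · intro n hn m
    rw [hκ_up hn]; exact sign n hn m
  · intro n hn m v hm hq
    rw [hκ_up hn]; exact selmer_off n hn m v hm hq
  · intro n hn m w
    rw [hκ_up hn]; exact selmer_inf n hn m w
  · intro n hn m q hq v hv
    rw [hκ_up hn]; exact toric_on n hn m q hq v hv
  · intro n hn m ℓ hℓ v hv
    rw [hκ_up hn]; exact transverse_on n hn m ℓ hℓ v hv
  · intro n hn m ℓ hℓ v hv
    rw [hκ_up hn, hκ_up hn]; exact relation n hn m ℓ hℓ v hv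
  · -- transport: the top level is never empty; the bottom is `∅` (TRANSFER) or non-empty (borrowed)
    intro n q₁ q₂ hq₁ hq₂ hbase
    have htop : (insert q₂ (insert q₁ n)).Nonempty := Finset.insert_nonempty _ _
    rw [hbase_up htop] at hbase
    rcases n.eq_empty_or_nonempty with rfl | hn
    · have hne : q₂ ≠ q₁ := fun h ↦ hq₂ (h ▸ Finset.mem_insert_self _ _)
      obtain ⟨m, d, hd⟩ := transport_bottom q₁ q₂ hne hbase
      exact ⟨m, by rw [hκ_bot]; exact hdat m ⟨d, hd⟩⟩
    · obtain ⟨m, hm⟩ := transport_upper n q₁ q₂ hn hq₁ hq₂ hbase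
      exact ⟨m, by rwa [hκ_up hn]⟩
  · intro n hn he h1
    rw [hκ_up hn]
    exact baseCase n hn he h1

/-- **The hybrid socket with the upper-level axioms owed at EVEN non-empty levels only** (odd levels filled by `0`
through `nonempty_levelKolyvaginSystemP_of_evenLevels`): the borrowed classes `κ₁` need the carrier's axioms at even
non-empty levels, `transport` between even non-empty bottoms and their two-prime tops, the BOTTOM TRANSFER at the
two-prime levels, and `baseCase` at even non-empty levels. [cite: WZhang2014, §3.1, Thm. 4.3, Thm. 7.2, §9] -/
theorem nonempty_levelKolyvaginSystemP_of_evenUpperLevels_of_bottomTransfer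
    (hK : IsImaginaryQuadratic K) (hH : SatisfiesHeegnerHypothesis (W.conductorNorm ℤ) K)
    (hβ : (4 * (W.conductorNorm ℤ : ℤ)) ∣ β ^ 2 - NumberField.discr K)
    (ε₀ : Finset (AdmQ W K p) → Bool)
    (κ₁ : Finset {ℓ // Zhang2014.IsKolyvaginPrime (W.conductorNorm ℤ) W K p ℓ} → Finset (AdmQ W K p) → Vp W K p)
    (sign : ∀ n : Finset (AdmQ W K p), n.Nonempty → Even n.card →
      ∀ m : Finset {ℓ // Zhang2014.IsKolyvaginPrime (W.conductorNorm ℤ) W K p ℓ},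
      conjAct W c ((p ^ 1 : ℕ) : ℤ) (κ₁ m n) = sgnP (ε₀ n ^^ Nat.bodd m.card) • κ₁ m n)
    (selmer_off : ∀ n : Finset (AdmQ W K p), n.Nonempty → Even n.card →
      ∀ (m : Finset {ℓ // Zhang2014.IsKolyvaginPrime (W.conductorNorm ℤ) W K p ℓ}) (v : HeightOneSpectrum (𝓞 K)),
      (∀ ℓ ∈ m, ((ℓ : ℕ) : 𝓞 K) ∉ v.asIdeal) → (∀ q ∈ n, ((q : ℕ) : 𝓞 K) ∉ v.asIdeal) →
      κ₁ m n ∈ selmerLocalKer (W.baseChange K) (v.adicCompletion K) ((p ^ 1 : ℕ) : ℤ))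
    (selmer_inf : ∀ n : Finset (AdmQ W K p), n.Nonempty → Even n.card →
      ∀ (m : Finset {ℓ // Zhang2014.IsKolyvaginPrime (W.conductorNorm ℤ) W K p ℓ}) (w : InfinitePlace K),
      κ₁ m n ∈ selmerLocalKer (W.baseChange K) w.Completion ((p ^ 1 : ℕ) : ℤ))
    (toric_on : ∀ n : Finset (AdmQ W K p), n.Nonempty → Even n.card →
      ∀ m : Finset {ℓ // Zhang2014.IsKolyvaginPrime (W.conductorNorm ℤ) W K p ℓ}, ∀ q ∈ n,
      ∀ v : HeightOneSpectrum (𝓞 K),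
      ((q : ℕ) : 𝓞 K) ∈ v.asIdeal → κ₁ m n ∈ toricLocalKer (W.baseChange K) (v.adicCompletion K) ((p ^ 1 : ℕ) : ℤ))
    (transverse_on : ∀ n : Finset (AdmQ W K p), n.Nonempty → Even n.card →
      ∀ m : Finset {ℓ // Zhang2014.IsKolyvaginPrime (W.conductorNorm ℤ) W K p ℓ}, ∀ ℓ ∈ m,
      ∀ v : HeightOneSpectrum (𝓞 K),
      ((ℓ : ℕ) : 𝓞 K) ∈ v.asIdeal → κ₁ m n ∈ transverseLocalKerP W K p ι ℓ v)
    (relation : ∀ n : Finset (AdmQ W K p), n.Nonempty → Even n.card →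
      ∀ (m : Finset {ℓ // Zhang2014.IsKolyvaginPrime (W.conductorNorm ℤ) W K p ℓ})
        (ℓ : {ℓ // Zhang2014.IsKolyvaginPrime (W.conductorNorm ℤ) W K p ℓ}), ℓ ∉ m → ∀ v : HeightOneSpectrum (𝓞 K),
      ((ℓ : ℕ) : 𝓞 K) ∈ v.asIdeal →
      (κ₁ (insert ℓ m) n ∈ (W.baseChange K).torsionLocalKer (v.adicCompletion K) ((p ^ 1 : ℕ) : ℤ) ↔
        κ₁ m n ∈ (W.baseChange K).torsionLocalKer (v.adicCompletion K) ((p ^ 1 : ℕ) : ℤ)))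
    (transport_upper : ∀ (n : Finset (AdmQ W K p)) (q₁ q₂ : AdmQ W K p), n.Nonempty →
      q₁ ∉ n → q₂ ∉ insert q₁ n → Even n.card →
      q₂ ∉ baseLocusQP W K p κ₁ (insert q₂ (insert q₁ n)) → ∃ m, κ₁ m n ≠ 0)
    (transport_bottom : ∀ q₁ q₂ : AdmQ W K p, q₂ ≠ q₁ →
      q₂ ∉ baseLocusQP W K p κ₁ (insert q₂ (insert q₁ (∅ : Finset (AdmQ W K p)))) →
      ∃ (m : Finset {ℓ // Zhang2014.IsKolyvaginPrime (W.conductorNorm ℤ) W K p ℓ})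
        (d : KolyvaginHeegnerData Dt β ι (∏ ℓ ∈ m, (ℓ : ℕ))), d.kolyvaginClass (Fact.out : p.Prime) 1 ≠ 0)
    (baseCase : ∀ n : Finset (AdmQ W K p), n.Nonempty → Even n.card →
      finrank (ZMod p) (SelQP W K p c n true) + finrank (ZMod p) (SelQP W K p c n false) = 1 → κ₁ ∅ n ≠ 0) :
    Nonempty (LevelKolyvaginSystemP W K p Dt β ι c) := by
  have hp : p.Prime := Fact.out
  let dat : ∀ m : Finset {ℓ // Zhang2014.IsKolyvaginPrime (W.conductorNorm ℤ) W K p ℓ},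
      KolyvaginHeegnerData Dt β ι (∏ ℓ ∈ m, (ℓ : ℕ)) := fun m ↦
    if h : ∃ d : KolyvaginHeegnerData Dt β ι (∏ ℓ ∈ m, (ℓ : ℕ)), d.kolyvaginClass hp 1 ≠ 0 then h.choose
    else Classical.choice (nonempty_kolyvaginHeegnerData_finsetProd W K p hK hH Dt β ι hβ m)
  have hdat : ∀ m : Finset {ℓ // Zhang2014.IsKolyvaginPrime (W.conductorNorm ℤ) W K p ℓ},
      (∃ d : KolyvaginHeegnerData Dt β ι (∏ ℓ ∈ m, (ℓ : ℕ)), d.kolyvaginClass hp 1 ≠ 0) →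
      (dat m).kolyvaginClass hp 1 ≠ 0 := by
    intro m h
    have hd : dat m = h.choose := dif_pos h
    rw [hd]
    exact h.choose_spec
  let κ : Finset {ℓ // Zhang2014.IsKolyvaginPrime (W.conductorNorm ℤ) W K p ℓ} → Finset (AdmQ W K p) → Vp W K p :=
    fun m n ↦ if n = ∅ then (dat m).kolyvaginClass hp 1 else κ₁ m n
  have hκ_bot : ∀ m, κ m ∅ = (dat m).kolyvaginClass hp 1 := fun m ↦ if_pos rfl
  have hκ_up : ∀ {n : Finset (AdmQ W K p)} (_ : n.Nonempty) (m), κ m n = κ₁ m n :=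
    fun hn m ↦ if_neg hn.ne_empty
  have hbase_up : ∀ {n : Finset (AdmQ W K p)} (_ : n.Nonempty), baseLocusQP W K p κ n = baseLocusQP W K p κ₁ n :=
    fun hn ↦ baseLocusQP_congr W K p fun m ↦ hκ_up hn m
  refine nonempty_levelKolyvaginSystemP_of_evenLevels W K p c Dt β ι ε₀ κ (fun m ↦ ⟨dat m, hκ_bot m⟩)
    (fun n hn he m ↦ by rw [hκ_up hn]; exact sign n hn he m)
    (fun n hn he m v hm hq ↦ by rw [hκ_up hn]; exact selmer_off n hn he m v hm hq)
    (fun n hn he m w ↦ by rw [hκ_up hn]; exact selmer_inf n hn he m w)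
    (fun n hn he m q hq v hv ↦ by rw [hκ_up hn]; exact toric_on n hn he m q hq v hv)
    (fun n hn he m ℓ hℓ v hv ↦ by rw [hκ_up hn]; exact transverse_on n hn he m ℓ hℓ v hv)
    (fun n hn he m ℓ hℓ v hv ↦ by rw [hκ_up hn, hκ_up hn]; exact relation n hn he m ℓ hℓ v hv)
    ?_ (fun n hn he h1 ↦ by rw [hκ_up hn]; exact baseCase n hn he h1)
  intro n q₁ q₂ hq₁ hq₂ he hbase
  have htop : (insert q₂ (insert q₁ n)).Nonempty := Finset.insert_nonempty _ _
  rw [hbase_up htop] at hbase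
  rcases n.eq_empty_or_nonempty with rfl | hn
  · have hne : q₂ ≠ q₁ := fun h ↦ hq₂ (h ▸ Finset.mem_insert_self _ _)
    obtain ⟨m, d, hd⟩ := transport_bottom q₁ q₂ hne hbase
    exact ⟨m, by rw [hκ_bot]; exact hdat m ⟨d, hd⟩⟩
  · obtain ⟨m, hm⟩ := transport_upper n q₁ q₂ hn hq₁ hq₂ he hbase
    exact ⟨m, by rwa [hκ_up hn]⟩

end Summit.BirchSwinnertonDyer.BirchSwinnertonDyer.Theorems.AdditiveKoly

end
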